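import Summits.Ventures.PackingBounds.ThreePointCert.SoundExactChecks
import Summits.Ventures.PackingBounds.SphericalCodes.TenTenthExact
import Summits.Ventures.PackingBounds.ThreePointCert.G27Expand1
import Summits.Ventures.PackingBounds.ThreePointCert.G27Expand2
import Summits.Ventures.PackingBounds.ThreePointCert.G27Expand3
import Summits.Ventures.PackingBounds.ThreePointCert.G27Expand4
import Summits.Ventures.PackingBounds.ThreePointCert.G27Expand5
import Summits.Ventures.PackingBounds.ThreePointCert.G27Expand6
import Summits.Ventures.PackingBounds.ThreePointCert.G27Expand7
import Summits.Ventures.PackingBounds.ThreePointCert.G27Expand8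
import Summits.Ventures.PackingBounds.ThreePointCert.G27Expand9

/-!
# A(10, arccos 1/10) ≤ 26: kernel instance of the exact value-27 three-point certificate — the kernel-checked theorem

Framing: lottery ticket; floor = certified bounds/negative ranges. Venture `PackingBounds` (cell
`pub-packcert`), recognition seat (T5: the ghost `srg(27, 20, 29/2, 15)`), three-point SDP family's exact
kernel format. Integer data of an EXACT (slack-free) Bachoc–Vallentin certificate of value exactly `27` for
`A(10, arccos 1/10)` (n = 10, s = 1/10, degree 6, symmetric sums of squares of Machado–de Oliveira Filho
type, `B = 0`; every block on the optimal face complementary to the ghost pseudo-configuration), produced by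
`pub-packcert-recog` gen 16 (`code/t5/kernel/job3.py` + `job4b.py`, the latter = `pub-packcert-lp` gen 4's
`job4.py` adapted) in the units of the kernel checker `ThreePointCert.CheckExact` (soundness
`ThreePointCert.SoundExact*`, built by `pub-packcert-lp` gen 4 for `A(9, arccos 1/3) ≤ 98`). Generated file:
plain lists of integers / monomials.
-/

noncomputable section

namespace Summit.Ventures.PackingBounds.ThreePointCert.G27

open Finset
open scoped RealInnerProductSpace
open Literature.Geometry.DiscreteGeometry Literature.Geometry.DiscreteGeometry.PolyCert PolyCert.SPoly
open Literature.Analysis.SpecialFunctions Summit.Ventures.PackingBounds.SphericalCodes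

set_option maxHeartbeats 0 in
/-- Shape conditions of `pR0trv`. -/
theorem shape_pR0trv : partShapeOK G27.pR0trv = true := by
  decide +kernel

set_option maxHeartbeats 0 in
/-- Shape conditions of `pR0alt`. -/
theorem shape_pR0alt : partShapeOK G27.pR0alt = true := by
  decide +kernel

set_option maxHeartbeats 0 in
/-- Shape conditions of `pR0std`. -/
theorem shape_pR0std : partShapeOK G27.pR0std = true := by
  decide +kernel

/-- All rows of the multiplier-0 parts are valid (composition of the kernel chunk checks). -/
theorem partsVal0 : PartsVal G27.parts0 G27.eTOT0 := by
  refine partsVal_of_from _ _ ?_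
  refine partsValFrom_cons pR0trv _ ([] : SPoly) d0_2 _ 23 (by decide) (pchunkVal_trans pR0trv 0 18 5 ([] : SPoly) d0_1 d0_2 (pchunkVal_of_ok pR0trv shape_pR0trv 0 18 ([] : SPoly) d0_1 ok_pR0trv_1) (pchunkVal_of_ok pR0trv shape_pR0trv 18 5 d0_1 d0_2 ok_pR0trv_2)) ?_
  refine partsValFrom_cons pR0alt _ d0_2 d0_3 _ 7 (by decide) (pchunkVal_of_ok pR0alt shape_pR0alt 0 7 d0_2 d0_3 ok_pR0alt_1) ?_
  refine partsValFrom_cons pR0std _ d0_3 eTOT0 _ 27 (by decide) (pchunkVal_trans pR0std 0 23 4 d0_3 d0_6 eTOT0 (pchunkVal_trans pR0std 0 17 6 d0_3 d0_5 d0_6 (pchunkVal_trans pR0std 0 9 8 d0_3 d0_4 d0_5 (pchunkVal_of_ok pR0std shape_pR0std 0 9 d0_3 d0_4 ok_pR0std_1) (pchunkVal_of_ok pR0std shape_pR0std 9 8 d0_4 d0_5 ok_pR0std_2)) (pchunkVal_of_ok pR0std shape_pR0std 17 6 d0_5 d0_6 ok_pR0std_3)) (pchunkVal_of_ok pR0std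 shape_pR0std 23 4 d0_6 eTOT0 ok_pR0std_4)) ?_
  exact partsValFrom_last _

set_option maxHeartbeats 0 in
/-- Shape conditions of `pR1trv`. -/
theorem shape_pR1trv : partShapeOK G27.pR1trv = true := by
  decide +kernel

set_option maxHeartbeats 0 in
/-- Shape conditions of `pR1alt`. -/
theorem shape_pR1alt : partShapeOK G27.pR1alt = true := by
  decide +kernel

set_option maxHeartbeats 0 in
/-- Shape conditions of `pR1std`. -/
theorem shape_pR1std : partShapeOK G27.pR1std = true := by
  decide +kernel

/-- All rows of the multiplier-1 parts are valid (composition of the kernel chunk checks). -/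
theorem partsVal1 : PartsVal G27.parts1 G27.eTOT1 := by
  refine partsVal_of_from _ _ ?_
  refine partsValFrom_cons pR1trv _ ([] : SPoly) d1_1 _ 16 (by decide) (pchunkVal_of_ok pR1trv shape_pR1trv 0 16 ([] : SPoly) d1_1 ok_pR1trv_1) ?_
  refine partsValFrom_cons pR1alt _ d1_1 d1_2 _ 4 (by decide) (pchunkVal_of_ok pR1alt shape_pR1alt 0 4 d1_1 d1_2 ok_pR1alt_1) ?_
  refine partsValFrom_cons pR1std _ d1_2 eTOT1 _ 18 (by decide) (pchunkVal_of_ok pR1std shape_pR1std 0 18 d1_2 eTOT1 ok_pR1std_1) ?_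
  exact partsValFrom_last _

set_option maxHeartbeats 0 in
/-- Shape conditions of `pR2trv`. -/
theorem shape_pR2trv : partShapeOK G27.pR2trv = true := by
  decide +kernel

set_option maxHeartbeats 0 in
/-- Shape conditions of `pR2alt`. -/
theorem shape_pR2alt : partShapeOK G27.pR2alt = true := by
  decide +kernel

set_option maxHeartbeats 0 in
/-- Shape conditions of `pR2std`. -/
theorem shape_pR2std : partShapeOK G27.pR2std = true := by
  decide +kernel

/-- All rows of the multiplier-2 parts are valid (composition of the kernel chunk checks). -/
theorem partsVal2 : PartsVal G27.parts2 G27.eTOT2 := by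
  refine partsVal_of_from _ _ ?_
  refine partsValFrom_cons pR2trv _ ([] : SPoly) d2_1 _ 11 (by decide) (pchunkVal_of_ok pR2trv shape_pR2trv 0 11 ([] : SPoly) d2_1 ok_pR2trv_1) ?_
  refine partsValFrom_cons pR2alt _ d2_1 d2_2 _ 2 (by decide) (pchunkVal_of_ok pR2alt shape_pR2alt 0 2 d2_1 d2_2 ok_pR2alt_1) ?_
  refine partsValFrom_cons pR2std _ d2_2 eTOT2 _ 11 (by decide) (pchunkVal_of_ok pR2std shape_pR2std 0 11 d2_2 eTOT2 ok_pR2std_1) ?_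
  exact partsValFrom_last _

set_option maxHeartbeats 0 in
/-- Shape conditions of `pR3trv`. -/
theorem shape_pR3trv : partShapeOK G27.pR3trv = true := by
  decide +kernel

set_option maxHeartbeats 0 in
/-- Shape conditions of `pR3alt`. -/
theorem shape_pR3alt : partShapeOK G27.pR3alt = true := by
  decide +kernel

set_option maxHeartbeats 0 in
/-- Shape conditions of `pR3std`. -/
theorem shape_pR3std : partShapeOK G27.pR3std = true := by
  decide +kernel

/-- All rows of the multiplier-3 parts are valid (composition of the kernel chunk checks). -/
theorem partsVal3 : PartsVal G27.parts3 G27.eTOT3 := by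
  refine partsVal_of_from _ _ ?_
  refine partsValFrom_cons pR3trv _ ([] : SPoly) d3_1 _ 7 (by decide) (pchunkVal_of_ok pR3trv shape_pR3trv 0 7 ([] : SPoly) d3_1 ok_pR3trv_1) ?_
  refine partsValFrom_cons pR3alt _ d3_1 d3_2 _ 1 (by decide) (pchunkVal_of_ok pR3alt shape_pR3alt 0 1 d3_1 d3_2 ok_pR3alt_1) ?_
  refine partsValFrom_cons pR3std _ d3_2 eTOT3 _ 6 (by decide) (pchunkVal_of_ok pR3std shape_pR3std 0 6 d3_2 eTOT3 ok_pR3std_1) ?_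
  exact partsValFrom_last _

set_option maxHeartbeats 0 in
/-- Shape conditions of `pR4trv`. -/
theorem shape_pR4trv : partShapeOK G27.pR4trv = true := by
  decide +kernel

set_option maxHeartbeats 0 in
/-- Shape conditions of `pR4alt`. -/
theorem shape_pR4alt : partShapeOK G27.pR4alt = true := by
  decide +kernel

set_option maxHeartbeats 0 in
/-- Shape conditions of `pR4std`. -/
theorem shape_pR4std : partShapeOK G27.pR4std = true := by
  decide +kernel

/-- All rows of the multiplier-4 parts are valid (composition of the kernel chunk checks). -/
theorem partsVal4 : PartsVal G27.parts4 G27.eTOT4 := by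
  refine partsVal_of_from _ _ ?_
  refine partsValFrom_cons pR4trv _ ([] : SPoly) d4_1 _ 11 (by decide) (pchunkVal_of_ok pR4trv shape_pR4trv 0 11 ([] : SPoly) d4_1 ok_pR4trv_1) ?_
  refine partsValFrom_cons pR4alt _ d4_1 d4_2 _ 2 (by decide) (pchunkVal_of_ok pR4alt shape_pR4alt 0 2 d4_1 d4_2 ok_pR4alt_1) ?_
  refine partsValFrom_cons pR4std _ d4_2 eTOT4 _ 11 (by decide) (pchunkVal_of_ok pR4std shape_pR4std 0 11 d4_2 eTOT4 ok_pR4std_1) ?_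
  exact partsValFrom_last _

/-- `cert.n = 10`. -/
theorem cert_n : G27.cert.n = 10 := rfl

/-- `cert.d = 6`. -/
theorem cert_d : G27.cert.d = 6 := rfl

/-- The three-point expansion is valid (composition of the kernel block-chunk checks). -/
theorem fval : FChunkValX G27.cert G27.cert.F [] G27.eFP := by
  have hF : cert.F = [fb0, fb1, fb2, fb3, fb4] := rfl
  rw [hF]
  have g1 : FChunkValX cert [fb0, fb1, fb2] ([] : SPoly) dF_1 := fchunkValX_of_ok cert [fb0, fb1, fb2] ([] : SPoly) dF_1 (by rw [cert_n, cert_d]; exact okF_1)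
  have g2 : FChunkValX cert [fb3, fb4] dF_1 eFP := fchunkValX_of_ok cert [fb3, fb4] dF_1 eFP (by rw [cert_n, cert_d]; exact okF_2)
  have c1 := g1
  have c2 : FChunkValX cert [fb0, fb1, fb2, fb3, fb4] [] eFP := by
    simpa only [List.cons_append, List.nil_append] using fchunkValX_append cert [fb0, fb1, fb2] [fb3, fb4] _ _ _ c1 g2
  exact c2

/-- All expansion data are valid. -/
theorem polys_ok : PolysOKX G27.cert G27.polys G27.gh0 G27.gh1 where
  hF := fval
  hT0 := partsVal0
  hT1 := partsVal1
  hT2 := partsVal2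
  hT3 := partsVal3
  hT4 := partsVal4
  hh0 := rvalid_of_single gh0 eEH0 okH0
  hh1 := rvalid_of_single gh1 eEH1 okH1

set_option maxHeartbeats 0 in
/-- The side conditions hold. -/
theorem cert_side : checkSideX G27.cert = true := by decide +kernel

set_option maxHeartbeats 0 in
/-- The exact value is `27`. -/
theorem cert_val : checkValX G27.cert G27.polys = true := by decide +kernel

set_option maxHeartbeats 0 in
/-- Constraint `(ii)` holds as an exact polynomial identity (on the pre-multiplied summands). -/
theorem cert_II : checkIIX2 G27.cert G27.polys G27.eP1 G27.eP2 G27.eP3 G27.eP4 = true := by decide +kernel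

set_option maxHeartbeats 0 in
/-- Constraint `(i)`: the exact factorisation `κ_Z · ZI = w · h`. -/
theorem cert_I : checkIZ G27.cert G27.polys = true := by decide +kernel

set_option maxHeartbeats 0 in
/-- Constraint `(i)`: the cofactor `h` is positive on `[-1, 1/10]` (slackful sums of squares). -/
theorem cert_H : checkH G27.cert G27.polys = true := by decide +kernel

/-- The positive two-point coefficients `A_1, A_2`. -/
theorem A_pos : 0 < G27.cert.A.getD 1 0 ∧ 0 < G27.cert.A.getD 2 0 := by
  decide +kernel

/-- The vanishing factor of `(i)`: `w(u) = (1-10u)(1+2u)²`. -/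
theorem eval_wP (u : ℝ) : eval G27.cert.wP u 0 0 = (1 - 10 * u) * (1 + 2 * u) ^ 2 := by
  show eval ewP u 0 0 = _
  simp [ewP, ofFlat, eval, Mono.eval]
  ring

/-- **A(10, arccos 1/10) ≤ 26 (kernel-checked)**: every finite set of unit vectors of `ℝ¹⁰` with pairwise inner
products `≤ 1/10` has at most `26` elements.  The Bachoc–Vallentin three-point bound itself is exactly `27` here
(this file's EXACT value-`27` certificate, degree 6, checked by `ThreePointCert.CheckExact` in the kernel); the
improvement to `26` is the complementary-slackness + integrality step `card_le_26_of_exact27_certificate`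
(`SphericalCodes.TenTenthExact` → `TenTenth.card_le_26_of_tight_certificate` → `GhostTwentySeven.no_ghost_config_27`):
a `27`-point code would be a centred two-distance tight frame with inner products `1/10, -1/2` — the non-existent
ghost `srg(27, 20, 29/2, 15)`.  Linear programming gives `31` at this cell.  [cite: BachocVallentin2007, Theorem 4.2] -/
theorem code_dim10_tenth_le_26 (C : Finset (EuclideanSpace ℝ (Fin 10)))
    (h1 : ∀ x ∈ C, ‖x‖ = 1) (h2 : ∀ x ∈ C, ∀ y ∈ C, x ≠ y → inner ℝ x y ≤ 1 / 10) : C.card ≤ 26 := by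
  have hs := cert_side
  have hP := polys_ok
  obtain ⟨-, -, -, -, hlam, hAlen, -⟩ := sideX_of_check cert hs
  have hl : (0 : ℝ) < cert.lam := by exact_mod_cast hlam
  have e : ((cert.p : ℤ) : ℝ) / (cert.q : ℕ) = 1 / 10 := by norm_num [cert]
  have hbox : ∀ u : ℝ, u ≤ 1 / 10 → u ≤ ((cert.p : ℤ) : ℝ) / (cert.q : ℕ) := fun u hu => by rw [e]; exact hu
  have hw : ∀ u : ℝ, -1 ≤ u → u ≤ 1 / 10 → 0 ≤ eval cert.wP u 0 0 := by
    intro u hu hu'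
    rw [eval_wP]
    have h3 : 0 ≤ 1 - 10 * u := by linarith
    positivity
  obtain ⟨hA1, hA2⟩ := A_pos
  refine card_le_26_of_exact27_certificate 6 (by norm_num) (fun k => (cert.A.getD k 0 : ℝ) / cert.lam)
    (fun k => by positivity) (div_pos (by exact_mod_cast hA1) hl) (div_pos (by exact_mod_cast hA2) hl)
    (AX cert) ?_ (FX cert) (fun D hD => tripleSum_FX_nonneg cert hs D hD) (FX_swap12 cert) (FX_swap23 cert) ?_ ?_ ?_ ?_ C h1 h2
  · -- A as a Gegenbauer sum with parameter 4
    intro t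
    rw [AX_eq_sum]
    have hN : ((cert.n : ℕ) : ℝ) = 10 := by norm_num [cert]
    have hL : cert.A.length = 6 + 1 := hAlen
    rw [hL, hN]
    norm_num
  · intro u hu hu'
    exact (AFX_of_check cert polys hP cert_I cert_H hs u hu (hbox u hu') (hw u hu hu')).1
  · intro u v t hu hu' hv hv' ht ht' hp
    exact FX_nonpos_of_check2 cert polys hP eP1 eP2 eP3 eP4 cert_II okM_1 okM_2 okM_3 okM_4 hs u v t
      hu (hbox u hu') hv (hbox v hv') ht (hbox t ht') hp
  · have hv := valX_of_check cert polys hP cert_val hs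
    have hN : ((cert.N : ℕ) : ℝ) = 27 := by norm_num [cert]
    rw [hN] at hv; exact hv
  · intro u hu hu' heq
    have hz := (AFX_of_check cert polys hP cert_I cert_H hs u hu (hbox u hu') (hw u hu hu')).2 heq
    rw [eval_wP] at hz
    rcases mul_eq_zero.1 hz with h | h
    · left; linarith
    · right
      have := pow_eq_zero_iff (two_ne_zero) |>.1 h
      linarith

end Summit.Ventures.PackingBounds.ThreePointCert.G27

end
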